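import Literature.Probability.Independence.ChernoffProductCount
import Literature.Computability.MetaComplexity.ThresholdWindowPolynomial
import Literature.Computability.MetaComplexity.LowDegreeComposition
import Literature.Computability.MetaComplexity.SmolenskyMajority
import Literature.Computability.MetaComplexity.LowDegPolynomialRepresentation
import Literature.Computability.MetaComplexity.ProbabilisticPolynomial
import HarnessLib

/-!
# The probabilistic degree of threshold tuples: the two constructions of STV 2021, Thm. 18

The base case and the inductive step of Srinivasan–Tripathi–Venkitesh 2021, Theorem 18
(positive characteristic), each as a stand-alone theorem about UNIFORM SEED FAMILIES of
low-degree functions on the cube (`UFam`: a finite seed type `Ω`, for each seed a tuple of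
functions in `Smolensky.lowDeg`, erring on at most `ε·|Ω|` seeds at every input):

* `UFam`, `UFam.mono`, `ufam_exact` (zero error, degree `n`), `hasProbDegree_of_ufam`
  (a seed family is a probabilistic poly-tuple in the sense of `HasProbDegree`, STV Def. 16);
* **base case** `ufam_thr_hash` (STV §3.1.1, "Base Case `ε ≤ 2^{-t/160000}`"): hash the
  variables into `r ≥ 40t` buckets, put an independent random `𝔽_p`-linear form on each bucket,
  and OR the exact threshold of the `r` Fermat indicators with the exact interpolant on the slice
  `|x| ≤ r`; degree `r·p`, error `≤ 2^{-r} + e^{-r/128}`;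
* **inductive step** `ufam_thr_step` (STV §3.1.1, "Inductive Construction", sampling rate
  `1/16`): from a seed family for the thresholds `(⌈tᵢ/16⌉, ⌈tᵢ/16⌉ + Δ, ⌈tᵢ/16⌉ − Δ)` on
  `⌈n/16⌉` variables build `T = N·E + (1 − N)·T'` on `n` variables (`E` the window polynomial
  of `ThresholdWindowPolynomial.lean`, `N`, `T'` read off a subsample drawn with replacement);
  degree `2D' + max(p(2W+1), D')`, error `ε₁ + ε₂` where `ε₁` bounds the two Chernoff counts
  (`ChernoffProductCount.lean`) in the explicit form the final assembly instantiates.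

The assembly (strong induction on `n`, the degree recursion with `A_p = B_p = 6.4·10⁶·p`) is in
`ProbabilisticDegreeThreshold.lean` (`STV2021_thresholdProbDegree_holds`).

## References

* S. Srinivasan, U. Tripathi, S. Venkitesh, *On the probabilistic degrees of symmetric Boolean
  functions*, SIAM J. Discrete Math. 35 (2021), Theorem 18 and §3.1.1 [SrinivasanTripathiVenkitesh2021].
* J. Alman, R. Williams, FOCS 2015, §3 (the recursive construction `M_{n,θ,ε}`) [AlmanWilliams2015].
-/

noncomputable section

namespace Literature.Computability.MetaComplexity

open Finset Real Literature.Computability.Complexity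
open Literature.Probability.Independence

namespace Smolensky

open scoped Classical

/-! ### Uniform seed families -/

section UFam

variable {F : Type*} [Field F] {n : ℕ} {κ : Type} [Fintype κ]

/-- The seeds at which the family `G` errs for the tuple `f` at input `x` (some coordinate is
not `[f_i(x)]`). [cite: SrinivasanTripathiVenkitesh2021, Definition 16] -/
def errSet {Ω : Type*} [Fintype Ω] (G : Ω → κ → CubeFn F n) (f : κ → (Fin n → Bool) → Bool)
    (x : Fin n → Bool) : Finset Ω :=
  univ.filter fun ω => ∃ i, G ω i x ≠ boolVal F (f i x)

/-- Membership in the error set (stated once, so that users never re-synthesize the decidability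
instance hidden in `errSet`). [cite: SrinivasanTripathiVenkitesh2021, Definition 16] -/
theorem mem_errSet {Ω : Type*} [Fintype Ω] {G : Ω → κ → CubeFn F n}
    {f : κ → (Fin n → Bool) → Bool} {x : Fin n → Bool} {ω : Ω} :
    ω ∈ errSet G f x ↔ ∃ i, G ω i x ≠ boolVal F (f i x) := by
  simp [errSet]

/-- **Uniform seed family** of degree `≤ D` and error `≤ ε` for the tuple `f`: a nonempty finite
seed type `Ω` and for every seed a `κ`-tuple of functions of degree `≤ D` on the cube, such that
at every input at most `ε·|Ω|` seeds err. (A probabilistic poly-tuple, STV Def. 16, whose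
distribution is uniform on `Ω`.) [cite: SrinivasanTripathiVenkitesh2021, Definition 16] -/
def UFam (F : Type*) [Field F] {n : ℕ} {κ : Type} [Fintype κ] (f : κ → (Fin n → Bool) → Bool)
    (ε : ℝ) (D : ℕ) : Prop :=
  ∃ (Ω : Type) (_ : Fintype Ω), Nonempty Ω ∧ ∃ G : Ω → κ → CubeFn F n,
    (∀ ω i, G ω i ∈ lowDeg F n D) ∧ ∀ x, ((errSet G f x).card : ℝ) ≤ ε * Fintype.card Ω

/-- Monotonicity in degree and error. [cite: SrinivasanTripathiVenkitesh2021, Definition 16] -/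
theorem UFam.mono {f : κ → (Fin n → Bool) → Bool} {ε ε' : ℝ} {D D' : ℕ} (h : UFam F f ε D)
    (hε : ε ≤ ε') (hD : D ≤ D') : UFam F f ε' D' := by
  obtain ⟨Ω, hΩ, hne, G, hdeg, herr⟩ := h
  exact ⟨Ω, hΩ, hne, G, fun ω i => lowDeg_mono hD (hdeg ω i), fun x =>
    (herr x).trans (mul_le_mul_of_nonneg_right hε (Nat.cast_nonneg _))⟩

/-- Every function on the cube has degree `≤ n`. [cite: Smolensky1987, p. 78 (every function on the cube is a multilinear polynomial)] -/
theorem mem_lowDeg_self (u : CubeFn F n) : u ∈ lowDeg F n n := by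
  have h : u ∈ Submodule.span F (Set.range (mono F (n := n))) := by
    rw [span_range_mono_eq_top]; exact Submodule.mem_top
  refine (Submodule.span_le.2 ?_) h
  rintro _ ⟨S, rfl⟩
  exact mono_mem_lowDeg (by simpa using S.card_le_univ)

/-- `boolVal` of a decision. [folklore] -/
private theorem boolVal_decide (P : Prop) [Decidable P] :
    boolVal F (decide P) = if P then 1 else 0 := by
  by_cases h : P <;> simp [boolVal, h]

/-- **Zero error, degree `n`**: the exact representation as a one-seed family (STV §3.1.1,
"Base Case `n ≤ 10`" / "`n ≤ r`"). [cite: SrinivasanTripathiVenkitesh2021, §3.1.1 (Base Case)] -/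
theorem ufam_exact (f : κ → (Fin n → Bool) → Bool) : UFam F f 0 n := by
  refine ⟨Unit, inferInstance, ⟨()⟩, fun _ i x => boolVal F (f i x), fun _ i => mem_lowDeg_self _,
    fun x => ?_⟩
  have h0 : errSet (fun (_ : Unit) i x => boolVal F (f i x)) f x = ∅ :=
    Finset.filter_eq_empty_iff.2 fun _ _ => by simp
  rw [h0, Finset.card_empty, Nat.cast_zero, zero_mul]

/-- **A uniform seed family is a probabilistic poly-tuple** (`HasProbDegree`, STV Def. 16): index
the seeds by `Fin |Ω|` and replace each function of degree `≤ D` by a polynomial of total degree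
`≤ D` representing it (`exists_poly_of_mem_lowDeg`). [cite: SrinivasanTripathiVenkitesh2021, Definition 16] -/
theorem hasProbDegree_of_ufam {m : ℕ} {f : Fin m → (Fin n → Bool) → Bool} {ε : ℝ} {D : ℕ}
    (h : UFam F f ε D) : HasProbDegree F f ε D := by
  obtain ⟨Ω, hΩ, hne, G, hdeg, herr⟩ := h
  choose P hPdeg hPeval using fun ω i => exists_poly_of_mem_lowDeg (hdeg ω i)
  refine hasProbDegree_of_uniform ⟨Fintype.card Ω, Fintype.card_pos, fun j i =>
    P ((Fintype.equivFin Ω).symm j) i, fun j i => hPdeg _ i, fun x => ?_⟩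
  refine le_trans ?_ (herr x)
  have hset : (univ.filter fun j : Fin (Fintype.card Ω) =>
      ProbPolyTuple.Errs f (fun i => P ((Fintype.equivFin Ω).symm j) i) x) =
      (errSet G f x).map (Fintype.equivFin Ω).toEmbedding := by
    ext j
    simp only [Finset.mem_filter, Finset.mem_univ, true_and, Finset.mem_map_equiv, errSet,
      ProbPolyTuple.Errs]
    refine exists_congr fun i => ?_
    rw [show (fun k => boolVal F (x k)) = (fun k => if x k then (1 : F) else 0) from rfl,
      ← hPeval]
  rw [hset, Finset.card_map]

end UFam

/-! ### Substituting a subsample keeps the degree -/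

section Sample

variable {F : Type*} [Field F] {n m : ℕ}

/-- Reading the input through a map `σ : Fin m → Fin n` (a subsample drawn with replacement)
does not increase the degree: `x ↦ P(x ∘ σ)` has degree `≤ D` if `P` has.
[cite: SrinivasanTripathiVenkitesh2021, §3.1.1 (each entry of x̂ is a degree-1 polynomial in x)] -/
theorem comp_sample_mem_lowDeg (σ : Fin m → Fin n) {D : ℕ} {P : CubeFn F m}
    (hP : P ∈ lowDeg F m D) : (fun x : Fin n → Bool => P (fun k => x (σ k))) ∈ lowDeg F n D :=
  comp_mem_lowDeg_of_coord (fun x : Fin n → Bool => fun k => x (σ k))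
    (fun k => bitFn_mem_lowDeg (σ k) le_rfl) hP

end Sample

/-! ### Base case: hashing and random linear forms (STV §3.1.1, Base Case `ε ≤ 2^{-t/160000}`) -/

section Hash

variable (p : ℕ) [hp : Fact p.Prime] {n : ℕ}

/-- The seeds of the base-case construction: a hash function `H : [n] → [r]` and, for every
bucket `j`, an independent coefficient vector `c_j ∈ 𝔽_pⁿ` (STV draw one coefficient `αᵢ` per
variable; drawing a fresh vector per bucket gives the same bucket forms in law and makes the
independence of the buckets syntactic). [cite: SrinivasanTripathiVenkitesh2021, §3.1.1 (Base Case: "Choose a uniformly random hash function H:[n]→[r] … Choose αᵢ ∼ 𝔽_p")] -/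
abbrev HashSeed (n r : ℕ) : Type := (Fin n → Fin r) × (Fin r → Fin n → ZMod p)

variable {p} {r : ℕ}

/-- The random linear form of bucket `j`: `L_j(x) = Σ_{i ∈ S_j} c_j(i)·xᵢ`, `S_j = H⁻¹(j)`.
[cite: SrinivasanTripathiVenkitesh2021, §3.1.1 (Base Case: L_j(x) = Σ_{i∈S_j} αᵢxᵢ)] -/
def bucketLin (ω : HashSeed p n r) (j : Fin r) : CubeFn (ZMod p) n :=
  fun x => ∑ i, if ω.1 i = j ∧ x i = true then ω.2 j i else 0

/-- The vector of "bucket `j` has a nonzero form" bits.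
[cite: SrinivasanTripathiVenkitesh2021, §3.1.1 (Base Case: the tuple (L_1^{p-1}(a),…,L_r^{p-1}(a)))] -/
def bucketVec (ω : HashSeed p n r) (x : Fin n → Bool) : Fin r → Bool :=
  fun j => decide (bucketLin ω j x ≠ 0)

/-- `P₂ = Q_r(L_1^{p-1},…,L_r^{p-1})`: the threshold-`s` function of the Fermat indicators of the
buckets. [cite: SrinivasanTripathiVenkitesh2021, §3.1.1 (Base Case: P_2^{(i)} = Q_r^{(i)}(L_1^{p-1},…,L_r^{p-1}))] -/
def hashThr (ω : HashSeed p n r) (s : ℕ) : CubeFn (ZMod p) n :=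
  fun x => if s ≤ GateFn.numOnes (bucketVec ω x) then 1 else 0

/-- `P₁ = Ex_{[0,r]} Thr^s`: a degree-`≤ r` function agreeing with `[s ≤ |x|]` on `|x| ≤ r`
(the tree's `exists_lowDeg_eq_on_lower`). [cite: SrinivasanTripathiVenkitesh2021, §3.1.1 (Base Case: P_1 = Ex_{[0,r]} T)] -/
def lowerThr (p : ℕ) [Fact p.Prime] (n r s : ℕ) : CubeFn (ZMod p) n :=
  (exists_lowDeg_eq_on_lower (F := ZMod p) (n := n) r
    (fun x => if s ≤ GateFn.numOnes x then 1 else 0)).choose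

/-- `lowerThr` has degree `≤ r` and is exact on the slice `|x| ≤ r`.
[cite: SrinivasanTripathiVenkitesh2021, Theorem 21] -/
theorem lowerThr_spec (n r s : ℕ) :
    lowerThr p n r s ∈ lowDeg (ZMod p) n r ∧ ∀ x : Fin n → Bool, GateFn.numOnes x ≤ r →
      lowerThr p n r s x = if s ≤ GateFn.numOnes x then 1 else 0 :=
  (exists_lowDeg_eq_on_lower (F := ZMod p) (n := n) r
    (fun x => if s ≤ GateFn.numOnes x then 1 else 0)).choose_spec

/-- **The base-case polynomial** `P = OR(P₁, P₂) = P₁ + P₂ − P₁P₂`.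
[cite: SrinivasanTripathiVenkitesh2021, §3.1.1 (Base Case: P = 1 − (1 − P_1)(1 − P_2))] -/
def hashFam (ω : HashSeed p n r) (s : ℕ) : CubeFn (ZMod p) n :=
  lowerThr p n r s + hashThr ω s - lowerThr p n r s * hashThr ω s

/-! #### Degree -/

/-- A bucket form has degree `≤ 1`. [cite: SrinivasanTripathiVenkitesh2021, §3.1.1 (Base Case)] -/
theorem bucketLin_mem_lowDeg (ω : HashSeed p n r) (j : Fin r) :
    bucketLin ω j ∈ lowDeg (ZMod p) n 1 := by
  have h : bucketLin ω j = ∑ i : Fin n, (if ω.1 i = j then ω.2 j i else 0) •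
      (fun x : Fin n → Bool => if x i then (1 : ZMod p) else 0) := by
    funext x
    unfold bucketLin
    rw [Finset.sum_apply]
    refine Finset.sum_congr rfl fun i _ => ?_
    simp only [Pi.smul_apply, smul_eq_mul]
    by_cases h1 : ω.1 i = j <;> by_cases h2 : x i = true <;> simp [h1, h2]
  rw [h]
  exact Submodule.sum_mem _ fun i _ => Submodule.smul_mem _ _ (bitFn_mem_lowDeg i le_rfl)

/-- The Fermat indicator `L_j^{p-1} = [L_j ≠ 0]` of a bucket has degree `≤ p − 1`.
[cite: SrinivasanTripathiVenkitesh2021, §3.1.1 (Base Case: deg(P_2) ≤ (p−1)·r)] -/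
theorem bucketVec_ind_mem_lowDeg (ω : HashSeed p n r) (j : Fin r) :
    (fun x : Fin n → Bool => if bucketVec ω x j = true then (1 : ZMod p) else 0) ∈
      lowDeg (ZMod p) n (p - 1) := by
  have h : (fun x : Fin n → Bool => if bucketVec ω x j = true then (1 : ZMod p) else 0) =
      bucketLin ω j ^ (p - 1) := by
    funext x
    simp only [bucketVec, decide_eq_true_eq, Pi.pow_apply]
    by_cases hz : bucketLin ω j x = 0
    · rw [if_neg (not_not.2 hz), hz, zero_pow]
      have := hp.out.two_le; omega
    · rw [if_pos hz, ZMod.pow_card_sub_one_eq_one hz]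
  rw [h]
  simpa using pow_mem_lowDeg (bucketLin_mem_lowDeg ω j) (p - 1)

/-- `P₂` has degree `≤ r(p−1)`. [cite: SrinivasanTripathiVenkitesh2021, §3.1.1 (Base Case: deg(P_2) ≤ (p−1)·r)] -/
theorem hashThr_mem_lowDeg (ω : HashSeed p n r) (s : ℕ) :
    hashThr ω s ∈ lowDeg (ZMod p) n (r * (p - 1)) :=
  comp_mem_lowDeg_of_coord_mul (F := ZMod p) (bucketVec ω) (bucketVec_ind_mem_lowDeg ω)
    (P := fun y : Fin r → Bool => if s ≤ GateFn.numOnes y then (1 : ZMod p) else 0)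
    (mem_lowDeg_self _)

/-- **Degree of the base-case polynomial**: `≤ r·p`.
[cite: SrinivasanTripathiVenkitesh2021, §3.1.1 (Base Case: deg(P) ≤ deg(P_1) + deg(P_2) ≤ p·r)] -/
theorem hashFam_mem_lowDeg (ω : HashSeed p n r) (s : ℕ) :
    hashFam ω s ∈ lowDeg (ZMod p) n (r * p) := by
  have h1 := (lowerThr_spec (p := p) n r s).1
  have h2 := hashThr_mem_lowDeg ω s
  have hp1 : 1 ≤ p := hp.out.one_lt.le
  have hr : r ≤ r * p := Nat.le_mul_of_pos_right _ hp.out.pos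
  have hr2 : r * (p - 1) ≤ r * p := Nat.mul_le_mul_left _ (Nat.sub_le _ _)
  have hr3 : r + r * (p - 1) = r * p := by
    rw [Nat.mul_sub_one]
    have := Nat.le_mul_of_pos_right r hp.out.pos
    omega
  unfold hashFam
  refine Submodule.sub_mem _ (Submodule.add_mem _ (lowDeg_mono hr h1) (lowDeg_mono hr2 h2)) ?_
  rw [← hr3]
  exact mul_mem_lowDeg_add h1 h2

/-! #### Deterministic behaviour -/

/-- The occupied buckets: `H(supp x)`. [cite: SrinivasanTripathiVenkitesh2021, §3.1.1 (Base Case: I(H) = {j : supp(a) ∩ S_j ≠ ∅})] -/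
def occ (H : Fin n → Fin r) (x : Fin n → Bool) : Finset (Fin r) :=
  (univ.filter fun i => x i = true).image H

omit hp in
/-- At most `|x|` buckets are occupied. [cite: SrinivasanTripathiVenkitesh2021, §3.1.1 (Base Case: |(L_j^{p-1}(a))_j| ≤ |a|)] -/
theorem card_occ_le (H : Fin n → Fin r) (x : Fin n → Bool) : (occ H x).card ≤ GateFn.numOnes x :=
  Finset.card_image_le

/-- A bucket with a nonzero form is occupied. [cite: SrinivasanTripathiVenkitesh2021, §3.1.1 (Base Case)] -/
theorem mem_occ_of_bucketLin_ne (ω : HashSeed p n r) (x : Fin n → Bool) {j : Fin r}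
    (h : bucketLin ω j x ≠ 0) : j ∈ occ ω.1 x := by
  obtain ⟨i, _, hi⟩ := Finset.exists_ne_zero_of_sum_ne_zero h
  have hc : ω.1 i = j ∧ x i = true := by
    by_contra hc; exact hi (if_neg hc)
  exact Finset.mem_image.2 ⟨i, Finset.mem_filter.2 ⟨Finset.mem_univ _, hc.2⟩, hc.1⟩

/-- The number of nonzero bucket forms equals the number of OCCUPIED buckets with a nonzero form
(and is at most the number of occupied buckets, hence at most `|x|`).
[cite: SrinivasanTripathiVenkitesh2021, §3.1.1 (Base Case: |(L_j^{p-1}(a))_j| ≤ |a|)] -/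
theorem numOnes_bucketVec_eq (ω : HashSeed p n r) (x : Fin n → Bool) :
    GateFn.numOnes (bucketVec ω x) = ((occ ω.1 x).filter fun j => bucketLin ω j x ≠ 0).card := by
  unfold GateFn.numOnes
  congr 1
  ext j
  simp only [Finset.mem_filter, Finset.mem_univ, true_and, bucketVec, decide_eq_true_eq]
  exact ⟨fun h => ⟨mem_occ_of_bucketLin_ne ω x h, h⟩, fun h => h.2⟩

/-- `#nonzero forms ≤ #occupied buckets`. [cite: SrinivasanTripathiVenkitesh2021, §3.1.1 (Base Case)] -/
theorem numOnes_bucketVec_le_card_occ (ω : HashSeed p n r) (x : Fin n → Bool) :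
    GateFn.numOnes (bucketVec ω x) ≤ (occ ω.1 x).card := by
  rw [numOnes_bucketVec_eq]
  exact Finset.card_filter_le _ _

/-- **When the base-case polynomial is correct**: at an input of weight `≤ r` always; at an input
of weight `> r` as soon as at least `t ≥ s` bucket forms are nonzero.
[cite: SrinivasanTripathiVenkitesh2021, §3.1.1 (Base Case, correctness: the cases Z_a, N_a with |a| ≤ r, |a| ≥ r)] -/
theorem hashFam_correct (ω : HashSeed p n r) {s t : ℕ} (hst : s ≤ t) (htr : t ≤ r)
    (x : Fin n → Bool)
    (hgood : r < GateFn.numOnes x → t ≤ GateFn.numOnes (bucketVec ω x)) :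
    hashFam ω s x = if s ≤ GateFn.numOnes x then 1 else 0 := by
  have hV : hashThr ω s x = if s ≤ GateFn.numOnes (bucketVec ω x) then 1 else 0 := rfl
  have happ : hashFam ω s x = lowerThr p n r s x + hashThr ω s x - lowerThr p n r s x * hashThr ω s x :=
    rfl
  rw [happ, hV]
  by_cases hxr : GateFn.numOnes x ≤ r
  · rw [(lowerThr_spec (p := p) n r s).2 x hxr]
    by_cases hs : s ≤ GateFn.numOnes x
    · rw [if_pos hs]; split_ifs <;> ring
    · rw [if_neg hs, if_neg]
      · ring
      · exact fun h => hs (h.trans ((numOnes_bucketVec_le_card_occ ω x).trans (card_occ_le _ _)))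
  · push Not at hxr
    rw [if_pos (hst.trans (hgood hxr)), if_pos (hst.trans (htr.trans hxr.le))]
    ring

/-! #### Counting the bad hash functions -/

omit hp in
/-- The hash functions sending `supp x` into a fixed set `I` number `|I|^{|x|} · r^{n − |x|}`.
[cite: SrinivasanTripathiVenkitesh2021, §3.1.1 (Base Case: Pr[I(H) ⊆ I] = (|I|/r)^{|a|})] -/
theorem card_filter_maps_into (x : Fin n → Bool) (I : Finset (Fin r)) :
    ((univ : Finset (Fin n → Fin r)).filter fun H => ∀ i, x i = true → H i ∈ I).card =
      I.card ^ GateFn.numOnes x * r ^ (n - GateFn.numOnes x) := by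
  have hset : ((univ : Finset (Fin n → Fin r)).filter fun H => ∀ i, x i = true → H i ∈ I) =
      Fintype.piFinset fun i => if x i = true then I else univ := by
    ext H
    simp only [Finset.mem_filter, Finset.mem_univ, true_and, Fintype.mem_piFinset]
    refine forall_congr' fun i => ?_
    by_cases h : x i = true <;> simp [h]
  rw [hset, Fintype.card_piFinset]
  have h2 : ∀ i, (if x i = true then I else (univ : Finset (Fin r))).card =
      if x i = true then I.card else r := by
    intro i; split_ifs <;> simp
  simp_rw [h2]
  rw [Finset.prod_ite, Finset.prod_const, Finset.prod_const]
  congr 1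
  have := Finset.card_filter_add_card_filter_not (s := (univ : Finset (Fin n)))
    (fun i => x i = true)
  rw [Finset.card_univ, Fintype.card_fin] at this
  unfold GateFn.numOnes
  congr 1
  omega

omit hp in
/-- **Few occupied buckets are rare**: the hash functions with at most `s₀` occupied buckets number
at most `C(r, s₀) · s₀^{|x|} · r^{n−|x|}` (`s₀ ≤ r`).
[cite: SrinivasanTripathiVenkitesh2021, §3.1.1 (Base Case: Pr[|I(H)| < r/10] ≤ C(r, r/10)·10^{-r})] -/
theorem card_filter_occ_le (x : Fin n → Bool) {s₀ : ℕ} (hs₀ : s₀ ≤ r) :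
    ((univ : Finset (Fin n → Fin r)).filter fun H => (occ H x).card ≤ s₀).card ≤
      r.choose s₀ * (s₀ ^ GateFn.numOnes x * r ^ (n - GateFn.numOnes x)) := by
  calc ((univ : Finset (Fin n → Fin r)).filter fun H => (occ H x).card ≤ s₀).card
      ≤ (((univ : Finset (Fin r)).powersetCard s₀).biUnion fun I =>
          (univ : Finset (Fin n → Fin r)).filter fun H => ∀ i, x i = true → H i ∈ I).card := by
        refine Finset.card_le_card fun H hH => ?_
        have hH' := (Finset.mem_filter.1 hH).2
        obtain ⟨I, hI, hIc⟩ := Finset.exists_superset_card_eq hH' (by simpa using hs₀)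
        refine Finset.mem_biUnion.2 ⟨I, Finset.mem_powersetCard.2 ⟨Finset.subset_univ _, hIc⟩,
          Finset.mem_filter.2 ⟨Finset.mem_univ _, fun i hi => hI ?_⟩⟩
        exact Finset.mem_image.2 ⟨i, Finset.mem_filter.2 ⟨Finset.mem_univ _, hi⟩, rfl⟩
    _ ≤ ∑ I ∈ (univ : Finset (Fin r)).powersetCard s₀,
          ((univ : Finset (Fin n → Fin r)).filter fun H => ∀ i, x i = true → H i ∈ I).card :=
        Finset.card_biUnion_le
    _ = ∑ I ∈ (univ : Finset (Fin r)).powersetCard s₀,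
          s₀ ^ GateFn.numOnes x * r ^ (n - GateFn.numOnes x) := by
        refine Finset.sum_congr rfl fun I hI => ?_
        rw [card_filter_maps_into, (Finset.mem_powersetCard.1 hI).2]
    _ = r.choose s₀ * (s₀ ^ GateFn.numOnes x * r ^ (n - GateFn.numOnes x)) := by
        rw [Finset.sum_const, Finset.card_powersetCard, Finset.card_univ, Fintype.card_fin,
          smul_eq_mul]

omit hp in
/-- The same bound in the form `≤ 2^{-r} · r^n` when `s₀ ≤ r/4` and `|x| ≥ r`.
[cite: SrinivasanTripathiVenkitesh2021, §3.1.1 (Base Case: ≤ 4^{-r} ≤ ε/4)] -/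
theorem card_filter_occ_le_real (x : Fin n → Bool) {s₀ : ℕ} (hs₀ : 4 * s₀ ≤ r)
    (hx : r ≤ GateFn.numOnes x) :
    (((univ : Finset (Fin n → Fin r)).filter fun H => (occ H x).card ≤ s₀).card : ℝ) ≤
      (1 / 2) ^ r * (r : ℝ) ^ n := by
  set A := GateFn.numOnes x with hA
  have hAn : A ≤ n := by
    rw [hA]; unfold GateFn.numOnes
    exact (Finset.card_le_univ _).trans (by simp)
  have h1 := card_filter_occ_le (n := n) x (show s₀ ≤ r by omega)
  have h2 : ((r.choose s₀ * (s₀ ^ A * r ^ (n - A)) : ℕ) : ℝ) ≤ (1 / 2) ^ r * (r : ℝ) ^ n := by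
    push_cast
    have hc : (r.choose s₀ : ℝ) ≤ 2 ^ r := by exact_mod_cast Nat.choose_le_two_pow r s₀
    have hs : (s₀ : ℝ) ≤ r / 4 := by
      have : ((4 * s₀ : ℕ) : ℝ) ≤ r := by exact_mod_cast hs₀
      push_cast at this; linarith
    have hs0 : (0 : ℝ) ≤ s₀ := Nat.cast_nonneg _
    have hr0 : (0 : ℝ) ≤ r := Nat.cast_nonneg _
    have h3 : (s₀ : ℝ) ^ A ≤ (r / 4) ^ A := pow_le_pow_left₀ hs0 hs A
    have h4 : (r / 4 : ℝ) ^ A * r ^ (n - A) = r ^ n * (1 / 4) ^ A := by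
      have e : (r : ℝ) ^ n = r ^ A * r ^ (n - A) := by rw [← pow_add, Nat.add_sub_cancel' hAn]
      rw [e, div_pow, div_pow, one_pow]; ring
    have h5 : (1 / 4 : ℝ) ^ A ≤ (1 / 4) ^ r := pow_le_pow_of_le_one (by norm_num) (by norm_num) hx
    have h6 : (2 : ℝ) ^ r * (1 / 4) ^ r = (1 / 2) ^ r := by
      rw [← mul_pow]; norm_num
    calc (r.choose s₀ : ℝ) * ((s₀ : ℝ) ^ A * r ^ (n - A))
        ≤ 2 ^ r * ((r / 4) ^ A * r ^ (n - A)) := by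
          gcongr
      _ = 2 ^ r * (r ^ n * (1 / 4) ^ A) := by rw [h4]
      _ ≤ 2 ^ r * (r ^ n * (1 / 4) ^ r) := by gcongr
      _ = (1 / 2) ^ r * r ^ n := by rw [← h6]; ring
  exact le_trans (by exact_mod_cast h1) h2

/-! #### Counting the bad coefficient vectors -/

/-- For an occupied bucket, at least half of the coefficient vectors give a nonzero form.
[cite: SrinivasanTripathiVenkitesh2021, §3.1.1 (Base Case: Pr[L_j(a) ≠ 0] = 1 − 1/p ≥ 1/2)] -/
theorem half_le_card_nonzero (H : Fin n → Fin r) (x : Fin n → Bool) {j : Fin r}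
    (hj : j ∈ occ H x) :
    (1 / 2 : ℝ) * Fintype.card (Fin n → ZMod p) ≤
      ((univ : Finset (Fin n → ZMod p)).filter fun v =>
        (∑ i, if H i = j ∧ x i = true then v i else 0) ≠ 0).card := by
  obtain ⟨i₀, hi₀, hHi₀⟩ := Finset.mem_image.1 hj
  have hx₀ : x i₀ = true := (Finset.mem_filter.1 hi₀).2
  have hn : 1 ≤ n := Nat.one_le_iff_ne_zero.2 fun h => by subst h; exact Fin.elim0 i₀
  -- the zero set injects into `{u : u i₀ = 0}`
  set Z := (univ : Finset (Fin n → ZMod p)).filter fun v =>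
    (∑ i, if H i = j ∧ x i = true then v i else 0) = 0 with hZ
  have hZle : Z.card ≤ p ^ (n - 1) := by
    have htarget : ((Fintype.piFinset fun i : Fin n =>
        if i = i₀ then ({0} : Finset (ZMod p)) else univ).card) = p ^ (n - 1) := by
      rw [Fintype.card_piFinset]
      have h2 : ∀ i : Fin n, (if i = i₀ then ({0} : Finset (ZMod p)) else univ).card =
          if i = i₀ then 1 else p := by
        intro i; split_ifs <;> simp [ZMod.card]
      simp_rw [h2]
      rw [Finset.prod_ite, Finset.prod_const_one, one_mul, Finset.prod_const]
      congr 1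
      rw [Finset.filter_ne' univ i₀, Finset.card_erase_of_mem (Finset.mem_univ _), Finset.card_univ,
        Fintype.card_fin]
    rw [← htarget]
    refine Finset.card_le_card_of_injOn (fun v => Function.update v i₀ 0) (fun v _ => ?_) ?_
    · rw [Finset.mem_coe, Fintype.mem_piFinset]
      intro i
      by_cases hi : i = i₀
      · subst hi; simp
      · simp [hi]
    · intro v hv w hw hvw
      have hv' := (Finset.mem_filter.1 (Finset.mem_coe.1 hv)).2
      have hw' := (Finset.mem_filter.1 (Finset.mem_coe.1 hw)).2
      have hoff : ∀ i, i ≠ i₀ → v i = w i := by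
        intro i hi
        have := congrFun hvw i
        dsimp only at this
        rwa [Function.update_of_ne hi, Function.update_of_ne hi] at this
      rw [← Finset.add_sum_erase _ _ (Finset.mem_univ i₀)] at hv' hw'
      have hrest : ∑ i ∈ univ.erase i₀, (if H i = j ∧ x i = true then v i else 0) =
          ∑ i ∈ univ.erase i₀, (if H i = j ∧ x i = true then w i else 0) :=
        Finset.sum_congr rfl fun i hi => by rw [hoff i (Finset.ne_of_mem_erase hi)]
      rw [if_pos ⟨hHi₀, hx₀⟩] at hv' hw'
      funext i
      by_cases hi : i = i₀
      · subst hi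
        rw [hrest] at hv'
        exact (eq_neg_of_add_eq_zero_left hv').trans (eq_neg_of_add_eq_zero_left hw').symm
      · exact hoff i hi
  -- complement count
  have hcard : (((univ : Finset (Fin n → ZMod p)).filter fun v =>
      (∑ i, if H i = j ∧ x i = true then v i else 0) ≠ 0).card : ℝ) =
      Fintype.card (Fin n → ZMod p) - Z.card := by
    rw [hZ, Finset.filter_not, Finset.card_sdiff_of_subset (Finset.filter_subset _ _), Finset.card_univ,
      Nat.cast_sub (Finset.card_le_univ _)]
  rw [hcard]
  have hN : (Fintype.card (Fin n → ZMod p) : ℝ) = (p : ℝ) ^ n := by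
    rw [Fintype.card_fun, ZMod.card, Fintype.card_fin]; push_cast; ring
  rw [hN]
  have hp2 : (2 : ℝ) ≤ p := by exact_mod_cast hp.out.two_le
  have hZr : (Z.card : ℝ) ≤ (p : ℝ) ^ (n - 1) := by exact_mod_cast hZle
  have hpow : (p : ℝ) ^ n = p * p ^ (n - 1) := by
    rw [← pow_succ', Nat.sub_add_cancel hn]
  have hp0 : (0 : ℝ) ≤ (p : ℝ) ^ (n - 1) := pow_nonneg (Nat.cast_nonneg _) _
  rw [hpow]
  nlinarith

/-- **Too few nonzero forms are rare** (Chernoff, lower tail): fix a hash function `H` and an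
input `x`, and let `o := #(occ H x)` be the number of occupied buckets. If `10·t ≤ o`, then the
coefficient draws `c` for which fewer than `t` of the bucket forms are nonzero at `x` number at
most `(pⁿ)^r · e^{-o/32}` (each occupied bucket's form is nonzero for at least half of the draws,
independently across buckets; Chernoff with `q = 1/2`, `λ = 1/4`, threshold `o/4 ≥ t`).
[cite: SrinivasanTripathiVenkitesh2021, §3.1.1 (Base Case: Pr[P_2(a) = 0 | H] < ε/2 by Bernstein)] -/
theorem card_filter_fewNonzero_le (H : Fin n → Fin r) (x : Fin n → Bool) {t : ℕ}
    (ht : 10 * t ≤ (occ H x).card) :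
    (((univ : Finset (Fin r → Fin n → ZMod p)).filter fun c =>
        GateFn.numOnes (bucketVec (H, c) x) < t).card : ℝ) ≤
      ((Fintype.card (Fin n → ZMod p) : ℝ) ^ r) * Real.exp (-((occ H x).card : ℝ) / 32) := by
  set o := (occ H x).card with ho
  -- Chernoff lower tail with q = 1/2, λ = 1/4, θ = o/4
  have hch := ChernoffCount.card_filter_cnt_le_le_exp (ι := Fin r) (X := Fin n → ZMod p)
    (fun j v => (∑ i, if H i = j ∧ x i = true then v i else 0) ≠ 0) (occ H x) (q := 1 / 2)
    (by norm_num) (fun j hj => by convert half_le_card_nonzero (p := p) H x hj) (lam := 1 / 4) (by norm_num)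
    (by norm_num) ((o : ℝ) / 4)
  have hexp : (1 / 2 : ℝ) * o * (1 / 4) ^ 2 - 1 / 4 * (o / 4) = -(o : ℝ) / 32 := by ring
  rw [hexp, Fintype.card_fin] at hch
  refine le_trans ?_ hch
  gcongr
  -- inclusion of the bad sets
  intro c hc
  simp only [Finset.mem_filter, Finset.mem_univ, true_and] at hc ⊢
  have hcnt : ChernoffCount.cnt (fun j v => (∑ i, if H i = j ∧ x i = true then v i else 0) ≠ 0)
      (occ H x) c = GateFn.numOnes (bucketVec (H, c) x) := by
    rw [numOnes_bucketVec_eq]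
    unfold ChernoffCount.cnt
    refine congrArg Finset.card ?_
    ext j
    simp only [Finset.mem_filter, bucketLin]
  rw [hcnt]
  have h1 : (GateFn.numOnes (bucketVec (H, c) x) : ℝ) + 1 ≤ t := by exact_mod_cast hc
  have h2 : ((10 * t : ℕ) : ℝ) ≤ o := by exact_mod_cast ht
  push_cast at h2
  linarith

/-! #### The base case assembled -/

/-- **Size of the seed space**. [folklore] -/
private theorem card_hashSeed (n r : ℕ) :
    (Fintype.card (HashSeed p n r) : ℝ) = (r : ℝ) ^ n * (Fintype.card (Fin n → ZMod p) : ℝ) ^ r := by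
  rw [Fintype.card_prod, Fintype.card_fun, Fintype.card_fin, Fintype.card_fin, Fintype.card_fun,
    Fintype.card_fin]
  push_cast
  ring

/-- **The bad seeds at a heavy input** (`|x| > r ≥ 40t`): at most `(2^{-r} + e^{-r/128})·|Ω|`.
[cite: SrinivasanTripathiVenkitesh2021, §3.1.1 (Base Case: Pr[P_2^{(m)}(a) = 0] ≤ ε)] -/
theorem card_badSeed_le (x : Fin n → Bool) {t : ℕ} (hr : 40 * t ≤ r) (hx : r < GateFn.numOnes x) :
    (((univ : Finset (HashSeed p n r)).filter fun ω =>
        GateFn.numOnes (bucketVec ω x) < t).card : ℝ) ≤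
      ((1 / 2) ^ r + Real.exp (-(r : ℝ) / 128)) * Fintype.card (HashSeed p n r) := by
  set s₀ := r / 4 with hs₀
  set N : ℝ := (Fintype.card (Fin n → ZMod p) : ℝ) with hN
  have hN0 : 0 ≤ N := Nat.cast_nonneg _
  -- split according to the number of occupied buckets
  set S₁ := (univ : Finset (HashSeed p n r)).filter fun ω => (occ ω.1 x).card ≤ s₀ with hS₁
  set S₂ := (univ : Finset (HashSeed p n r)).filter fun ω =>
    s₀ < (occ ω.1 x).card ∧ GateFn.numOnes (bucketVec ω x) < t with hS₂
  have hsub : ((univ : Finset (HashSeed p n r)).filter fun ω =>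
      GateFn.numOnes (bucketVec ω x) < t) ⊆ S₁ ∪ S₂ := by
    intro ω hω
    simp only [hS₁, hS₂, Finset.mem_union, Finset.mem_filter, Finset.mem_univ, true_and] at hω ⊢
    by_cases h : (occ ω.1 x).card ≤ s₀
    · exact Or.inl h
    · exact Or.inr ⟨not_le.1 h, hω⟩
  -- first part: a product set
  have hS₁card : (S₁.card : ℝ) ≤ (1 / 2) ^ r * (r : ℝ) ^ n * N ^ r := by
    have hprod : S₁ = ((univ : Finset (Fin n → Fin r)).filter fun H => (occ H x).card ≤ s₀) ×ˢ
        (univ : Finset (Fin r → Fin n → ZMod p)) := by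
      ext ω
      simp [hS₁]
    rw [hprod, Finset.card_product, Nat.cast_mul, Finset.card_univ, hN, Fintype.card_fun,
      Fintype.card_fin]
    push_cast
    have h := card_filter_occ_le_real (n := n) (r := r) x (s₀ := s₀) (by omega) hx.le
    exact mul_le_mul_of_nonneg_right h (by positivity)
  -- second part: sum over the hash function
  have hS₂card : (S₂.card : ℝ) ≤ (r : ℝ) ^ n * (N ^ r * Real.exp (-(r : ℝ) / 128)) := by
    have hsum : S₂.card = ∑ H : Fin n → Fin r, ((univ : Finset (Fin r → Fin n → ZMod p)).filter
        fun c => s₀ < (occ H x).card ∧ GateFn.numOnes (bucketVec (H, c) x) < t).card := by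
      rw [hS₂, Finset.card_filter, Fintype.sum_prod_type]
      refine Finset.sum_congr rfl fun H _ => ?_
      rw [Finset.card_filter]
    rw [hsum, Nat.cast_sum]
    have hterm : ∀ H : Fin n → Fin r, (((univ : Finset (Fin r → Fin n → ZMod p)).filter
        fun c => s₀ < (occ H x).card ∧ GateFn.numOnes (bucketVec (H, c) x) < t).card : ℝ) ≤
        N ^ r * Real.exp (-(r : ℝ) / 128) := by
      intro H
      by_cases ho : s₀ < (occ H x).card
      · have hfilt : ((univ : Finset (Fin r → Fin n → ZMod p)).filter
            fun c => s₀ < (occ H x).card ∧ GateFn.numOnes (bucketVec (H, c) x) < t) =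
            (univ : Finset (Fin r → Fin n → ZMod p)).filter
              fun c => GateFn.numOnes (bucketVec (H, c) x) < t := by
          ext c; simp [ho]
        rw [hfilt]
        have h10 : 10 * t ≤ (occ H x).card := by omega
        refine (card_filter_fewNonzero_le (p := p) H x h10).trans ?_
        rw [← hN]
        refine mul_le_mul_of_nonneg_left (Real.exp_le_exp.2 ?_) (by positivity)
        have : ((r : ℝ) / 4) < (occ H x).card := by
          have h1 : ((s₀ + 1 : ℕ) : ℝ) ≤ (occ H x).card := by exact_mod_cast ho
          have h2 : (r : ℝ) < 4 * ((s₀ : ℝ) + 1) := by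
            have : r < 4 * (s₀ + 1) := by omega
            exact_mod_cast this
          push_cast at h1; linarith
        linarith
      · have hfilt : ((univ : Finset (Fin r → Fin n → ZMod p)).filter
            fun c => s₀ < (occ H x).card ∧ GateFn.numOnes (bucketVec (H, c) x) < t) = ∅ := by
          ext c; simp [ho]
        rw [hfilt, Finset.card_empty, Nat.cast_zero]
        positivity
    calc ∑ H : Fin n → Fin r, (((univ : Finset (Fin r → Fin n → ZMod p)).filter
          fun c => s₀ < (occ H x).card ∧ GateFn.numOnes (bucketVec (H, c) x) < t).card : ℝ)
        ≤ ∑ _H : Fin n → Fin r, N ^ r * Real.exp (-(r : ℝ) / 128) := Finset.sum_le_sum fun H _ => hterm H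
      _ = (r : ℝ) ^ n * (N ^ r * Real.exp (-(r : ℝ) / 128)) := by
          rw [Finset.sum_const, Finset.card_univ, Fintype.card_fun, Fintype.card_fin, Fintype.card_fin,
            nsmul_eq_mul]
          push_cast; ring
  calc (((univ : Finset (HashSeed p n r)).filter fun ω =>
          GateFn.numOnes (bucketVec ω x) < t).card : ℝ)
      ≤ ((S₁ ∪ S₂).card : ℝ) := by exact_mod_cast Finset.card_le_card hsub
    _ ≤ (S₁.card : ℝ) + S₂.card := by exact_mod_cast Finset.card_union_le _ _
    _ ≤ (1 / 2) ^ r * (r : ℝ) ^ n * N ^ r + (r : ℝ) ^ n * (N ^ r * Real.exp (-(r : ℝ) / 128)) :=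
        add_le_add hS₁card hS₂card
    _ = ((1 / 2) ^ r + Real.exp (-(r : ℝ) / 128)) * Fintype.card (HashSeed p n r) := by
        rw [card_hashSeed, ← hN]; ring

/-- **STV 2021, Thm. 18, base case `ε ≤ 2^{-t/160000}` (hashing construction)**: for `r ≥ 40t`,
`r ≥ 1`, every threshold tuple with thresholds `≤ t` on `n` variables has a uniform seed family
over `𝔽_p` of degree `≤ r·p` and error `≤ 2^{-r} + e^{-r/128}`.
[cite: SrinivasanTripathiVenkitesh2021, Theorem 18 (proof, §3.1.1 Base Case)] -/
theorem ufam_thr_hash {κ : Type} [Fintype κ] (ts : κ → ℕ) {t : ℕ} (hts : ∀ i, ts i ≤ t)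
    (hr : 40 * t ≤ r) (hr1 : 1 ≤ r) :
    UFam (ZMod p) (n := n) (fun i x => decide (ts i ≤ GateFn.numOnes x))
      ((1 / 2) ^ r + Real.exp (-(r : ℝ) / 128)) (r * p) := by
  have hne : Nonempty (HashSeed p n r) := by
    have : Nonempty (Fin r) := ⟨⟨0, hr1⟩⟩
    infer_instance
  refine ⟨HashSeed p n r, inferInstance, hne, fun ω i => hashFam ω (ts i),
    fun ω i => hashFam_mem_lowDeg ω (ts i), fun x => ?_⟩
  have htr : t ≤ r := by omega
  by_cases hx : r < GateFn.numOnes x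
  · refine le_trans ?_ (card_badSeed_le (p := p) x hr hx)
    gcongr
    intro ω hω
    simp only [Finset.mem_filter, Finset.mem_univ, true_and]
    rw [mem_errSet] at hω
    by_contra hgood
    push Not at hgood
    obtain ⟨i, hi⟩ := hω
    exact hi (by rw [hashFam_correct ω (hts i) htr x fun _ => hgood, boolVal_decide])
  · have h0 : ∀ ω, ω ∉ errSet (fun ω i => hashFam (p := p) (n := n) (r := r) ω (ts i))
        (fun i x => decide (ts i ≤ GateFn.numOnes x)) x := fun ω hω => by
      rw [mem_errSet] at hω
      obtain ⟨i, hi⟩ := hω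
      exact hi (by rw [hashFam_correct ω (hts i) htr x fun h => absurd h hx, boolVal_decide])
    rw [Finset.subset_empty.1 fun ω hω => (h0 ω hω).elim, Finset.card_empty, Nat.cast_zero]
    positivity

end Hash

/-! ### Inductive step: subsample, recurse, interpolate (STV §3.1.1, Inductive Construction) -/

section Step

variable {p : ℕ} [hp : Fact p.Prime] {n : ℕ} {κ : Type} [Fintype κ]

/-- The subsample size `⌈n/16⌉` (STV sample `n/10` coordinates; we use rate `1/16`).
[cite: SrinivasanTripathiVenkitesh2021, §3.1.1 (Inductive Construction: a random subvector x̂ of length n/10)] -/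
def sub16 (n : ℕ) : ℕ := (n + 15) / 16

omit hp in
/-- `n ≤ 16·⌈n/16⌉ ≤ n + 15`. [cite: SrinivasanTripathiVenkitesh2021, §3.1.1 (Inductive Construction: subvector of length n/10)] -/
theorem sub16_bounds (n : ℕ) : n ≤ 16 * sub16 n ∧ 16 * sub16 n ≤ n + 15 := by
  unfold sub16; omega

/-- The three thresholds handed to the recursion for coordinate `i`: `⌈tᵢ/16⌉` (the rescaled
threshold, `T'`), `⌈tᵢ/16⌉ + Δ` (`T''₊`) and `⌈tᵢ/16⌉ − Δ` (`T''₋`).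
[cite: SrinivasanTripathiVenkitesh2021, §3.1.1 (Inductive Construction: T', T''_+, T''_-)] -/
def recThr (ts : κ → ℕ) (Δ : ℕ) : κ × Fin 3 → ℕ := fun ib =>
  if ib.2 = 0 then sub16 (ts ib.1) else if ib.2 = 1 then sub16 (ts ib.1) + Δ else sub16 (ts ib.1) - Δ

/-- `T = N''·E + (1 − N'')·T'` with `N'' = (1 − T''₊)·T''₋` (pointwise on the cube).
[cite: SrinivasanTripathiVenkitesh2021, §3.1.1 (Inductive Construction: T(x) = N''(x̂)E(x) + (1 − N'')(x̂)T'(x̂))] -/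
def combine {F : Type*} [Field F] (Tm Tp Tn E : CubeFn F n) : CubeFn F n :=
  ((1 - Tp) * Tn) * E + (1 - (1 - Tp) * Tn) * Tm

omit hp in
/-- Degree of the combination: `2D' + M` if `T', T''_± ∈ lowDeg D'`, `E ∈ lowDeg M`, `D' ≤ M`.
[cite: SrinivasanTripathiVenkitesh2021, §3.1.1 (Correctness of Degree: deg T ≤ deg T''_+ + deg T''_- + max{deg E, deg T'})] -/
theorem combine_mem_lowDeg {F : Type*} [Field F] {Tm Tp Tn E : CubeFn F n} {D' M : ℕ}
    (hm : Tm ∈ lowDeg F n D') (hp' : Tp ∈ lowDeg F n D') (hn' : Tn ∈ lowDeg F n D')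
    (hE : E ∈ lowDeg F n M) (hDM : D' ≤ M) : combine Tm Tp Tn E ∈ lowDeg F n (2 * D' + M) := by
  have hN : (1 - Tp) * Tn ∈ lowDeg F n (D' + D') :=
    mul_mem_lowDeg_add (Submodule.sub_mem _ (one_mem_lowDeg D') hp') hn'
  unfold combine
  rw [two_mul]
  refine Submodule.add_mem _ (mul_mem_lowDeg_add hN hE) ?_
  exact lowDeg_mono (by omega) (mul_mem_lowDeg_add (Submodule.sub_mem _ (one_mem_lowDeg _) hN) hm)

omit hp in
/-- If `T''₊(x) = 1` then `T(x) = T'(x)`. [cite: SrinivasanTripathiVenkitesh2021, §3.1.1 (Correctness: N''_i(â) = 0 ⇒ T_i(a) = T'_i(â))] -/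
theorem combine_apply_of_pos {F : Type*} [Field F] (Tm Tp Tn E : CubeFn F n) (x : Fin n → Bool)
    (h : Tp x = 1) : combine Tm Tp Tn E x = Tm x := by
  simp only [combine, Pi.add_apply, Pi.mul_apply, Pi.sub_apply, Pi.one_apply, h]
  ring

omit hp in
/-- If `T''₋(x) = 0` then `T(x) = T'(x)`. [cite: SrinivasanTripathiVenkitesh2021, §3.1.1 (Correctness: N''_i(â) = 0 ⇒ T_i(a) = T'_i(â))] -/
theorem combine_apply_of_neg {F : Type*} [Field F] (Tm Tp Tn E : CubeFn F n) (x : Fin n → Bool)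
    (h : Tn x = 0) : combine Tm Tp Tn E x = Tm x := by
  simp only [combine, Pi.add_apply, Pi.mul_apply, Pi.sub_apply, Pi.one_apply, h]
  ring

omit hp in
/-- If `T''₊(x) = 0` and `T''₋(x) = 1` then `T(x) = E(x)`. [cite: SrinivasanTripathiVenkitesh2021, §3.1.1 (Correctness: N''_i(â) = 1 ⇒ T_i(a) = E_i(a))] -/
theorem combine_apply_of_near {F : Type*} [Field F] (Tm Tp Tn E : CubeFn F n) (x : Fin n → Bool)
    (h1 : Tp x = 0) (h2 : Tn x = 1) : combine Tm Tp Tn E x = E x := by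
  simp only [combine, Pi.add_apply, Pi.mul_apply, Pi.sub_apply, Pi.one_apply, h1, h2]
  ring

/-- **Deterministic core of the inductive step.** At an input `a` of weight `A`, with subsample
weight `X` whose mean `μ` satisfies `A ≤ 16μ ≤ A + 15`, thresholds `s = ⌈tᵢ/16⌉`, margin
`Δ ≥ θ + 1`, window `W ≥ 16(Δ + θ + 1)`: if the three recursive values are correct and either
(light input) `|X − μ| < θ` or (heavy input, `A ≥ 2tᵢ + 32(Δ+1)`) `X > μ/2`, then
`T(a) = [tᵢ ≤ A]`. [cite: SrinivasanTripathiVenkitesh2021, Theorem 18 (proof, §3.1.1 "Correctness of Inductive Construction": the three bullet cases and the case |a| > 2t)] -/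
theorem combine_thr_correct {Tm Tp Tn : CubeFn (ZMod p) n} {a : Fin n → Bool} {X s Δ W tsi : ℕ}
    {μ θ : ℝ} (hv0 : Tm a = if s ≤ X then 1 else 0) (hv1 : Tp a = if s + Δ ≤ X then 1 else 0)
    (hv2 : Tn a = if s - Δ ≤ X then 1 else 0) (hslo : tsi ≤ 16 * s) (hshi : 16 * s ≤ tsi + 15)
    (hθ : 0 ≤ θ) (hΔ : θ + 1 ≤ Δ) (hW : 16 * ((Δ : ℝ) + θ + 1) ≤ W)
    (hμlo : (GateFn.numOnes a : ℝ) ≤ 16 * μ) (hμhi : 16 * μ ≤ GateFn.numOnes a + 15)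
    (hdev : ((X : ℝ) < μ + θ ∧ μ - θ < X) ∨
      (2 * (tsi : ℝ) + 32 * ((Δ : ℝ) + 1) ≤ GateFn.numOnes a ∧ μ / 2 < X)) :
    combine Tm Tp Tn (windowThr p tsi W) a = if tsi ≤ GateFn.numOnes a then 1 else 0 := by
  set A := GateFn.numOnes a with hA
  have hslo' : ((tsi : ℕ) : ℝ) ≤ 16 * (s : ℝ) := by exact_mod_cast hslo
  have hshi' : 16 * (s : ℝ) ≤ tsi + 15 := by exact_mod_cast hshi
  have hA0 : (0 : ℝ) ≤ A := Nat.cast_nonneg _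
  rcases hdev with ⟨hXhi, hXlo⟩ | ⟨hheavy, hXhalf⟩
  · by_cases hα : s + Δ ≤ X
    · -- far above: T''₊ = 1, answer T' = 1 = truth
      rw [combine_apply_of_pos _ _ _ _ a (by rw [hv1, if_pos hα]), hv0,
        if_pos (le_trans (Nat.le_add_right _ _) hα), if_pos]
      have h1 : ((s : ℝ) + Δ) ≤ X := by exact_mod_cast hα
      have h2 : ((tsi : ℕ) : ℝ) < A := by linarith
      exact_mod_cast h2.le
    · push Not at hα
      have hX1 : ((X : ℕ) : ℝ) + 1 ≤ (s : ℝ) + Δ := by exact_mod_cast hα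
      by_cases hβ : s - Δ ≤ X
      · -- near: the window polynomial is exact
        rw [combine_apply_of_near _ _ _ _ a (by rw [hv1, if_neg (not_le.2 hα)]) (by rw [hv2, if_pos hβ])]
        refine windowThr_apply p tsi W a ?_ ?_
        · -- tsi ≤ A + W
          by_cases hsΔ : Δ ≤ s
          · have h1 : ((s : ℝ) - Δ) ≤ X := by
              have : ((s - Δ : ℕ) : ℝ) ≤ X := by exact_mod_cast hβ
              rwa [Nat.cast_sub hsΔ] at this
            have h2 : ((tsi : ℕ) : ℝ) ≤ A + W := by linarith
            exact_mod_cast h2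
          · have h3 : ((tsi : ℕ) : ℝ) ≤ 16 * (Δ : ℝ) := by
              have : tsi ≤ 16 * Δ := by omega
              exact_mod_cast this
            have h2 : ((tsi : ℕ) : ℝ) ≤ A + W := by linarith
            exact_mod_cast h2
        · -- A ≤ tsi + W
          have h2 : (A : ℝ) ≤ tsi + W := by linarith
          exact_mod_cast h2
      · -- far below: T''₋ = 0, answer T' = 0 = truth
        push Not at hβ
        rw [combine_apply_of_neg _ _ _ _ a (by rw [hv2, if_neg (not_le.2 hβ)]), hv0,
          if_neg (fun h => absurd (lt_of_lt_of_le hβ (Nat.sub_le _ _)) (not_lt.2 h)), if_neg]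
        have hsΔ : Δ ≤ s := by omega
        have h1 : ((X : ℕ) : ℝ) + 1 ≤ (s : ℝ) - Δ := by
          have : ((X + 1 : ℕ) : ℝ) ≤ ((s - Δ : ℕ) : ℝ) := by exact_mod_cast hβ
          rwa [Nat.cast_sub hsΔ, Nat.cast_add, Nat.cast_one] at this
        have h2 : (A : ℝ) < tsi := by linarith
        have h3 : A < tsi := by exact_mod_cast h2
        omega
  · -- heavy input: X > μ/2 ≥ s + Δ
    have hα : s + Δ ≤ X := by
      have h1 : ((s : ℝ) + Δ) < X := by linarith
      exact_mod_cast h1.le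
    rw [combine_apply_of_pos _ _ _ _ a (by rw [hv1, if_pos hα]), hv0,
      if_pos (le_trans (Nat.le_add_right _ _) hα), if_pos]
    have h2 : ((tsi : ℕ) : ℝ) ≤ A := by nlinarith
    exact_mod_cast h2

/-- The family of the inductive step at seed `(σ, ω')`: read `T', T''_±` for coordinate `i` off
the recursive family at the subsample `x ∘ σ`, and combine with the window polynomial of `tᵢ`.
[cite: SrinivasanTripathiVenkitesh2021, §3.1.1 (Inductive Construction)] -/
def stepFam (n : ℕ) {Ω' : Type*} (G' : Ω' → κ × Fin 3 → CubeFn (ZMod p) (sub16 n)) (ts : κ → ℕ)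
    (W : ℕ) (ω : (Fin (sub16 n) → Fin n) × Ω') (i : κ) : CubeFn (ZMod p) n :=
  combine (fun x => G' ω.2 (i, 0) fun k => x (ω.1 k)) (fun x => G' ω.2 (i, 1) fun k => x (ω.1 k))
    (fun x => G' ω.2 (i, 2) fun k => x (ω.1 k)) (windowThr p (ts i) W)

omit hp in
/-- The Chernoff success count of a subsample is its weight. [folklore] -/
private theorem cnt_sample_eq (a : Fin n → Bool) {m : ℕ} (σ : Fin m → Fin n) :
    ChernoffCount.cnt (fun (_ : Fin m) (i : Fin n) => a i = true) univ σ =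
      GateFn.numOnes (fun k => a (σ k)) := by
  unfold ChernoffCount.cnt GateFn.numOnes
  refine congrArg Finset.card ?_
  ext k
  simp only [Finset.mem_filter]

/-- **STV 2021, Thm. 18 — the inductive step as a theorem.** Parameters: thresholds `tᵢ ≤ t`,
a deviation allowance `θ ≥ 0`, an integer margin `Δ ≥ θ + 1`, a window `W ≥ 16(Δ + θ + 1)`;
`A₀ = 2t + 32(Δ+1)` separates light from heavy inputs and `μ_max = A₀/16 + 1` bounds the mean
subsample weight of a light input (`θ ≤ 2μ_max`). If the deviation budget `ε₁` dominates the two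
Chernoff counts (`2e^{-θ²/(4μ_max)} ≤ ε₁` and `e^{-A₀/256} ≤ ε₁`) and the recursion supplies a
seed family of degree `D'` and error `ε₂` for the thresholds `(⌈tᵢ/16⌉, ⌈tᵢ/16⌉ ± Δ)ᵢ` on
`⌈n/16⌉` variables, then the thresholds `(tᵢ)ᵢ` on `n` variables have a seed family of degree
`2D' + max(p(2W+1), D')` and error `ε₁ + ε₂`.
[cite: SrinivasanTripathiVenkitesh2021, Theorem 18 (proof, §3.1.1 Inductive Construction and its correctness)] -/
theorem ufam_thr_step (hn : 0 < n) (ts : κ → ℕ) {t : ℕ} (hts : ∀ i, ts i ≤ t) {θ : ℝ} (hθ : 0 ≤ θ)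
    {Δ W : ℕ} (hΔ : θ + 1 ≤ Δ) (hW : 16 * ((Δ : ℝ) + θ + 1) ≤ W) {ε₁ ε₂ : ℝ}
    (hθμ : θ ≤ 2 * (((2 * t + 32 * (Δ + 1) : ℕ) : ℝ) / 16 + 1))
    (hε₁a : 2 * Real.exp (-(θ ^ 2 / (4 * (((2 * t + 32 * (Δ + 1) : ℕ) : ℝ) / 16 + 1)))) ≤ ε₁)
    (hε₁b : Real.exp (-((2 * t + 32 * (Δ + 1) : ℕ) : ℝ) / 256) ≤ ε₁)
    {D' : ℕ} (hrec : UFam (ZMod p) (n := sub16 n) (κ := κ × Fin 3)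
      (fun ib y => decide (recThr ts Δ ib ≤ GateFn.numOnes y)) ε₂ D') :
    UFam (ZMod p) (n := n) (fun i x => decide (ts i ≤ GateFn.numOnes x)) (ε₁ + ε₂)
      (2 * D' + max (p * (2 * W + 1)) D') := by
  obtain ⟨Ω', hΩ', hne', G', hdeg', herr'⟩ := hrec
  set A₀ : ℕ := 2 * t + 32 * (Δ + 1) with hA₀
  set μmax : ℝ := (A₀ : ℝ) / 16 + 1 with hμmax
  have hμmax0 : 0 < μmax := by positivity
  haveI : Nonempty (Fin (sub16 n) → Fin n) := ⟨fun _ => ⟨0, hn⟩⟩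
  -- the recursive tuple and its error sets, abbreviated
  set f' : κ × Fin 3 → (Fin (sub16 n) → Bool) → Bool :=
    fun ib y => decide (recThr ts Δ ib ≤ GateFn.numOnes y) with hf'
  refine ⟨(Fin (sub16 n) → Fin n) × Ω', inferInstance, inferInstance, stepFam (p := p) n G' ts W,
    fun ω i => ?_, fun a => ?_⟩
  · -- degree
    exact combine_mem_lowDeg (comp_sample_mem_lowDeg ω.1 (hdeg' ω.2 (i, 0)))
      (comp_sample_mem_lowDeg ω.1 (hdeg' ω.2 (i, 1))) (comp_sample_mem_lowDeg ω.1 (hdeg' ω.2 (i, 2)))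
      (windowThr_mem_lowDeg p (ts i) W (le_max_left _ _)) (le_max_right _ _)
  · -- error at input `a`
    set A := GateFn.numOnes a with hA
    have hAn : A ≤ n := by
      rw [hA]; unfold GateFn.numOnes; exact (Finset.card_le_univ _).trans (by simp)
    set μ : ℝ := (A : ℝ) / n * (sub16 n : ℕ) with hμ
    have hn0 : (0 : ℝ) < n := by exact_mod_cast hn
    have hA0 : (0 : ℝ) ≤ A := Nat.cast_nonneg _
    have hμlo : (A : ℝ) ≤ 16 * μ := by
      have h1 : ((n : ℕ) : ℝ) ≤ 16 * ((sub16 n : ℕ) : ℝ) := by exact_mod_cast (sub16_bounds n).1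
      rw [hμ]
      calc (A : ℝ) = A / n * n := by field_simp
        _ ≤ A / n * (16 * (sub16 n : ℕ)) := mul_le_mul_of_nonneg_left h1 (by positivity)
        _ = 16 * (A / n * (sub16 n : ℕ)) := by ring
    have hμhi : 16 * μ ≤ A + 15 := by
      have h1 : 16 * ((sub16 n : ℕ) : ℝ) ≤ n + 15 := by exact_mod_cast (sub16_bounds n).2
      have hAn' : (A : ℝ) ≤ n := by exact_mod_cast hAn
      have hdiv : (A : ℝ) / n ≤ 1 := by rw [div_le_one hn0]; exact hAn'
      rw [hμ]
      calc 16 * ((A : ℝ) / n * (sub16 n : ℕ)) = A / n * (16 * (sub16 n : ℕ)) := by ring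
        _ ≤ A / n * (n + 15) := mul_le_mul_of_nonneg_left h1 (by positivity)
        _ = A / n * n + 15 * (A / n) := by ring
        _ = A + 15 * (A / n) := by field_simp
        _ ≤ A + 15 * 1 := by gcongr
        _ = A + 15 := by ring
    have hμ0 : 0 ≤ μ := by positivity
    -- Chernoff data: good = supp a for every coordinate, q = A / n
    have hgood_eq : ((univ.filter fun i : Fin n => a i = true).card : ℝ) =
        A / n * Fintype.card (Fin n) := by
      rw [Fintype.card_fin]; field_simp; rfl
    have hgood_le : ((univ.filter fun i : Fin n => a i = true).card : ℝ) ≤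
        A / n * Fintype.card (Fin n) := hgood_eq.le
    have hgood_ge : (A : ℝ) / n * Fintype.card (Fin n) ≤
        ((univ.filter fun i : Fin n => a i = true).card : ℝ) := hgood_eq.ge
    have hq0 : (0 : ℝ) ≤ A / n := by positivity
    have hI₀ : (A : ℝ) / n * (univ : Finset (Fin (sub16 n))).card = μ := by
      rw [Finset.card_univ, Fintype.card_fin]
    -- the bad subsamples
    set devBad : Finset (Fin (sub16 n) → Fin n) :=
      if A < A₀ then
        (univ.filter fun σ => μ + θ ≤ (GateFn.numOnes (fun k => a (σ k)) : ℝ)) ∪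
          (univ.filter fun σ => (GateFn.numOnes (fun k => a (σ k)) : ℝ) ≤ μ - θ)
      else univ.filter fun σ => (GateFn.numOnes (fun k => a (σ k)) : ℝ) ≤ μ - μ / 2 with hdevBad
    have hdev : (devBad.card : ℝ) ≤ ε₁ * (n : ℝ) ^ sub16 n := by
      have hn0' : (0 : ℝ) ≤ (n : ℝ) ^ sub16 n := by positivity
      by_cases hlt : A < A₀
      · rw [hdevBad, if_pos hlt]
        have hμle : μ ≤ μmax := by
          have : ((A : ℕ) : ℝ) + 1 ≤ A₀ := by exact_mod_cast hlt
          rw [hμmax]; linarith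
        set lam := θ / (2 * μmax) with hlam
        have hlam0 : 0 ≤ lam := by positivity
        have hlam1 : lam ≤ 1 := by
          rw [hlam, div_le_one (by positivity)]; exact hθμ
        have hexpo : μ * lam ^ 2 - lam * θ ≤ -(θ ^ 2 / (4 * μmax)) := by
          have h1 : μ * lam ^ 2 ≤ μmax * lam ^ 2 := mul_le_mul_of_nonneg_right hμle (sq_nonneg _)
          have h2 : μmax * lam ^ 2 - lam * θ = -(θ ^ 2 / (4 * μmax)) := by
            rw [hlam]; field_simp; ring
          linarith
        have hup := ChernoffCount.card_filter_le_cnt_le_exp (ι := Fin (sub16 n)) (X := Fin n)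
          (fun _ i => a i = true) univ hq0 (fun _ _ => by convert hgood_le using 4) hlam0 hlam1 θ
        have hlo := ChernoffCount.card_filter_cnt_le_le_exp (ι := Fin (sub16 n)) (X := Fin n)
          (fun _ i => a i = true) univ hq0 (fun _ _ => by convert hgood_ge using 4) hlam0 hlam1 θ
        rw [hI₀, Fintype.card_fin, Fintype.card_fin] at hup hlo
        simp only [cnt_sample_eq] at hup hlo
        have hexp2 : Real.exp (μ * lam ^ 2 - lam * θ) ≤ Real.exp (-(θ ^ 2 / (4 * μmax))) :=
          Real.exp_le_exp.2 hexpo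
        have hup' : ((univ.filter fun σ : Fin (sub16 n) → Fin n =>
              μ + θ ≤ (GateFn.numOnes (fun k => a (σ k)) : ℝ)).card : ℝ) ≤
            (n : ℝ) ^ sub16 n * Real.exp (μ * lam ^ 2 - lam * θ) := by convert hup using 6
        have hlo' : ((univ.filter fun σ : Fin (sub16 n) → Fin n =>
              (GateFn.numOnes (fun k => a (σ k)) : ℝ) ≤ μ - θ).card : ℝ) ≤
            (n : ℝ) ^ sub16 n * Real.exp (μ * lam ^ 2 - lam * θ) := by convert hlo using 6
        calc (((univ.filter fun σ : Fin (sub16 n) → Fin n =>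
                μ + θ ≤ (GateFn.numOnes (fun k => a (σ k)) : ℝ)) ∪
              (univ.filter fun σ => (GateFn.numOnes (fun k => a (σ k)) : ℝ) ≤ μ - θ)).card : ℝ)
            ≤ ((univ.filter fun σ : Fin (sub16 n) → Fin n =>
                  μ + θ ≤ (GateFn.numOnes (fun k => a (σ k)) : ℝ)).card : ℝ) +
                ((univ.filter fun σ : Fin (sub16 n) → Fin n =>
                  (GateFn.numOnes (fun k => a (σ k)) : ℝ) ≤ μ - θ).card : ℝ) := by
              exact_mod_cast Finset.card_union_le _ _
          _ ≤ (n : ℝ) ^ sub16 n * Real.exp (μ * lam ^ 2 - lam * θ) +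
                (n : ℝ) ^ sub16 n * Real.exp (μ * lam ^ 2 - lam * θ) :=
              add_le_add hup' hlo'
          _ ≤ (n : ℝ) ^ sub16 n * Real.exp (-(θ ^ 2 / (4 * μmax))) +
                (n : ℝ) ^ sub16 n * Real.exp (-(θ ^ 2 / (4 * μmax))) := by gcongr
          _ = (2 * Real.exp (-(θ ^ 2 / (4 * μmax)))) * (n : ℝ) ^ sub16 n := by ring
          _ ≤ ε₁ * (n : ℝ) ^ sub16 n := mul_le_mul_of_nonneg_right hε₁a hn0'
      · rw [hdevBad, if_neg hlt]
        have hge : ((A₀ : ℕ) : ℝ) ≤ A := by exact_mod_cast not_lt.1 hlt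
        have hlo := ChernoffCount.card_filter_cnt_le_le_exp (ι := Fin (sub16 n)) (X := Fin n)
          (fun _ i => a i = true) univ hq0 (fun _ _ => by convert hgood_ge using 4)
          (lam := 1 / 4) (by norm_num) (by norm_num) (μ / 2)
        rw [hI₀, Fintype.card_fin, Fintype.card_fin] at hlo
        simp only [cnt_sample_eq] at hlo
        have hexpo : μ * (1 / 4) ^ 2 - 1 / 4 * (μ / 2) ≤ -(A₀ : ℝ) / 256 := by
          have : (A₀ : ℝ) ≤ 16 * μ := hge.trans hμlo
          nlinarith
        calc (((univ.filter fun σ : Fin (sub16 n) → Fin n =>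
              (GateFn.numOnes (fun k => a (σ k)) : ℝ) ≤ μ - μ / 2)).card : ℝ)
            ≤ (n : ℝ) ^ sub16 n * Real.exp (μ * (1 / 4) ^ 2 - 1 / 4 * (μ / 2)) := by
              convert hlo using 6
          _ ≤ (n : ℝ) ^ sub16 n * Real.exp (-(A₀ : ℝ) / 256) := by gcongr
          _ ≤ ε₁ * (n : ℝ) ^ sub16 n := by
              rw [mul_comm]; exact mul_le_mul_of_nonneg_right hε₁b hn0'
    -- deterministic core: outside the bad sets every coordinate is right
    have hcore : ∀ σ : Fin (sub16 n) → Fin n, σ ∉ devBad → ∀ ω' : Ω',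
        ω' ∉ errSet G' f' (fun k => a (σ k)) →
        ∀ i, stepFam (p := p) n G' ts W (σ, ω') i a = boolVal (ZMod p) (decide (ts i ≤ A)) := by
      intro σ hσ ω' hω' i
      have hval : ∀ b : Fin 3, G' ω' (i, b) (fun k => a (σ k)) =
          if recThr ts Δ (i, b) ≤ GateFn.numOnes (fun k => a (σ k)) then 1 else 0 := by
        intro b
        have h1 : ¬ (G' ω' (i, b) (fun k => a (σ k)) ≠ boolVal (ZMod p) (f' (i, b) fun k => a (σ k))) :=
          fun hne => hω' (mem_errSet.2 ⟨(i, b), hne⟩)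
        rw [not_not.1 h1, hf', boolVal_decide]
      have hr0 : recThr ts Δ (i, 0) = sub16 (ts i) := by simp [recThr]
      have hr1 : recThr ts Δ (i, 1) = sub16 (ts i) + Δ := by simp [recThr]
      have hr2 : recThr ts Δ (i, 2) = sub16 (ts i) - Δ := by simp [recThr]
      rw [boolVal_decide]
      refine combine_thr_correct (p := p) (s := sub16 (ts i)) (Δ := Δ) (μ := μ) (θ := θ)
        (X := GateFn.numOnes (fun k => a (σ k))) (by rw [hval 0, hr0]) (by rw [hval 1, hr1])
        (by rw [hval 2, hr2]) (sub16_bounds (ts i)).1 (sub16_bounds (ts i)).2 hθ hΔ hW hμlo hμhi ?_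
      by_cases hlt : A < A₀
      · left
        rw [hdevBad, if_pos hlt] at hσ
        simp only [Finset.mem_union, Finset.mem_filter, Finset.mem_univ, true_and, not_or, not_le] at hσ
        exact ⟨hσ.1, by linarith [hσ.2]⟩
      · right
        rw [hdevBad, if_neg hlt] at hσ
        simp only [Finset.mem_filter, Finset.mem_univ, true_and, not_le] at hσ
        refine ⟨?_, by linarith⟩
        have h1 : 2 * ts i + 32 * (Δ + 1) ≤ A := by have := hts i; omega
        exact_mod_cast h1
    -- union bound
    set E₂ : Finset ((Fin (sub16 n) → Fin n) × Ω') :=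
      univ.filter fun ω => ω.2 ∈ errSet G' f' (fun k => a (ω.1 k)) with hE₂
    have hsub : errSet (stepFam (p := p) n G' ts W) (fun i x => decide (ts i ≤ GateFn.numOnes x)) a ⊆
        devBad ×ˢ (univ : Finset Ω') ∪ E₂ := by
      intro ω hω
      rw [Finset.mem_union, Finset.mem_product]
      by_contra hc
      simp only [not_or, not_and, Finset.mem_univ, not_true, imp_false] at hc
      have hc2 : ω.2 ∉ errSet G' f' (fun k => a (ω.1 k)) := fun h =>
        hc.2 (Finset.mem_filter.2 ⟨Finset.mem_univ _, h⟩)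
      have hall := hcore ω.1 hc.1 ω.2 hc2
      rw [mem_errSet] at hω
      obtain ⟨i, hi⟩ := hω
      exact hi (hall i)
    have hE₂card : (E₂.card : ℝ) ≤ ε₂ * ((n : ℝ) ^ sub16 n * Fintype.card Ω') := by
      have hsum : E₂.card = ∑ σ : Fin (sub16 n) → Fin n, (errSet G' f' (fun k => a (σ k))).card := by
        rw [hE₂, Finset.card_filter, Fintype.sum_prod_type]
        refine Finset.sum_congr rfl fun σ _ => ?_
        dsimp only
        rw [← Finset.card_filter, Finset.filter_mem_eq_inter, Finset.univ_inter]
      rw [hsum, Nat.cast_sum]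
      calc ∑ σ : Fin (sub16 n) → Fin n, ((errSet G' f' (fun k => a (σ k))).card : ℝ)
          ≤ ∑ _σ : Fin (sub16 n) → Fin n, ε₂ * Fintype.card Ω' := Finset.sum_le_sum fun σ _ => herr' _
        _ = ε₂ * ((n : ℝ) ^ sub16 n * Fintype.card Ω') := by
          rw [Finset.sum_const, Finset.card_univ, Fintype.card_fun, Fintype.card_fin, Fintype.card_fin,
            nsmul_eq_mul]
          push_cast; ring
    have hcardΩ : (Fintype.card ((Fin (sub16 n) → Fin n) × Ω') : ℝ) =
        (n : ℝ) ^ sub16 n * Fintype.card Ω' := by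
      rw [Fintype.card_prod, Fintype.card_fun, Fintype.card_fin, Fintype.card_fin]; push_cast; ring
    calc ((errSet (stepFam (p := p) n G' ts W) (fun i x => decide (ts i ≤ GateFn.numOnes x)) a).card : ℝ)
        ≤ ((devBad ×ˢ (univ : Finset Ω') ∪ E₂).card : ℝ) := by exact_mod_cast Finset.card_le_card hsub
      _ ≤ ((devBad ×ˢ (univ : Finset Ω')).card : ℝ) + E₂.card := by
          exact_mod_cast Finset.card_union_le _ _
      _ = (devBad.card : ℝ) * Fintype.card Ω' + E₂.card := by
          rw [Finset.card_product, Finset.card_univ, Nat.cast_mul]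
      _ ≤ ε₁ * (n : ℝ) ^ sub16 n * Fintype.card Ω' + ε₂ * ((n : ℝ) ^ sub16 n * Fintype.card Ω') :=
          add_le_add (mul_le_mul_of_nonneg_right hdev (Nat.cast_nonneg _)) hE₂card
      _ = (ε₁ + ε₂) * Fintype.card ((Fin (sub16 n) → Fin n) × Ω') := by rw [hcardΩ]; ring

end Step

end Smolensky

end Literature.Computability.MetaComplexity
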